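import Summits.CriticalPhenomena.PercolationContinuityZ3.Theorems.PercNearOneGluingNoHeavyConstsLinearLowerTailFive
import HarnessLib

/-!
# (LT³⁄₂) for six relay points (observer among them), by dropping a point

builds on p205010 (kernel theorem, internal audit signed; external expert review pending)

PAPER-2 track "percolation constants", part (ii), seat `prim-consts-1` (lane index `run/shared/lean/prim/consts/CONSTANTS.md`,
row A19, §4 N18–N19).  Support file for the crux `NoHeavyLowerTail` (stmt-CriticalPhenomena-4575; `--supports … --as helper`):
theorems only, standard axioms.

With `o ∈ A` and `|A| = 6`, the bad event `{1 ≤ N < κ·EN}` (`κ ≤ 2/3`, so `κ·EN ≤ 4`) forces `N ≤ 3`, i.e. `o` is cut from at least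
THREE of the other five relay points — hence from at least two of any four of them, an event of probability `≤ (3/2)·s` by the
five-point anti-halving theorem `Consts.real_two_le_lost_le_three_halves` (`…ConstsLinearLowerTailFive`, vdBHK Thm. 1.3 + a
degree-2 certificate).  So (LT³⁄₂) holds for every instance with `o ∈ A` and `|A| ≤ 6`; no new correlation input is needed at
`|A| = 6` (where, incidentally, no hub-leaf extremiser fits: the numerical supremum under the same constraints is `≈ 1.38 < 3/2`,
kit j122968).

* `Consts.real_lowerTail_le_three_halves_of_card_le_six`, `Consts.linearLowerTailThreeHalves_of_card_le_six`.

References: J. van den Berg, O. Häggström, J. Kahn, Random Structures Algorithms 29 (2006) 417–435, Thm. 1.3 (p. 6);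
G. Kozma, N. Nitzan, arXiv:2401.12397 (2024), Conjecture 1 (p. 3).
-/

noncomputable section

namespace Summit.CriticalPhenomena.PercolationContinuityZ3.Theorems

open MeasureTheory Set Literature.Probability.LatticeModels Literature.Probability.Percolation
open scoped Classical

namespace Consts

/-- **(LT³⁄₂) for `o ∈ A`, `|A| ≤ 6`, every `κ ≤ 2/3`** (all finite weighted graphs, all `s`): `P(1 ≤ N < κ·EN) ≤ (3/2)·s`.
For `|A| ≤ 5` this is `Consts.real_lowerTail_le_three_halves_of_card_le_five`; for `|A| = 6` the bad event forces `N ≤ 3`, so `o`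
loses at least three of the other five relay points, hence at least two of four fixed ones, and
`Consts.real_two_le_lost_le_three_halves` applies to those four. [cite: KozmaNitzan2024, Conj. 1 (p. 3)] -/
theorem real_lowerTail_le_three_halves_of_card_le_six (n : ℕ) (w : Sym2 (Fin n) → unitInterval) (A : Finset (Fin n))
    (o : Fin n) (ho : o ∈ A) (hA : A.card ≤ 6) {κ s : ℝ} (hκ : κ ≤ 2 / 3)
    (hrel : ∀ a ∈ A, ∀ a' ∈ A, (prodBernoulli w).real (openConn a a')ᶜ ≤ s) :
    (prodBernoulli w).real {ω : BondConfig (Fin n) | 1 ≤ (A.filter fun a => ω ∈ openConn o a).card ∧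
        ((A.filter fun a => ω ∈ openConn o a).card : ℝ) < κ * (∑ a ∈ A, (prodBernoulli w).real (openConn o a))} ≤
      3 / 2 * s := by
  set μ := prodBernoulli w with hμ
  by_cases h5 : A.card ≤ 5
  · exact real_lowerTail_le_three_halves_of_card_le_five n w A o ho h5 hκ hrel
  have h6 : A.card = 6 := by omega
  -- drop one relay point `a ≠ o` and enumerate four of the remaining ones
  have hBne : (A.erase o).Nonempty := by
    rw [← Finset.card_pos, Finset.card_erase_of_mem ho, h6]; norm_num
  obtain ⟨a, ha⟩ := hBne
  have hao : a ≠ o := (Finset.mem_erase.1 ha).1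
  have haA : a ∈ A := (Finset.mem_erase.1 ha).2
  set B := (A.erase o).erase a with hB
  have hBcard : B.card = 4 := by
    rw [hB, Finset.card_erase_of_mem ha, Finset.card_erase_of_mem ho, h6]
  set ε := B.equivFinOfCardEq hBcard with hε
  set x : Fin 4 → Fin n := fun k => ((ε.symm k : B) : Fin n) with hx
  have hxB : ∀ k, x k ∈ B := fun k => (ε.symm k).2
  have hxo : ∀ k, x k ≠ o := fun k => (Finset.mem_erase.1 (Finset.mem_erase.1 (hxB k)).2).1
  have hxA : ∀ k, x k ∈ A := fun k => (Finset.mem_erase.1 (Finset.mem_erase.1 (hxB k)).2).2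
  have hxinj : Function.Injective x := by
    intro k k' hkk'
    have : ε.symm k = ε.symm k' := Subtype.ext hkk'
    exact ε.symm.injective this
  have hBmap : B = Finset.univ.map ⟨x, hxinj⟩ := by
    ext b
    simp only [Finset.mem_map, Finset.mem_univ, Function.Embedding.coeFn_mk, true_and]
    constructor
    · intro hb
      exact ⟨ε ⟨b, hb⟩, by simp [hx]⟩
    · rintro ⟨k, rfl⟩
      exact hxB k
  have hso : ∀ k, μ.real (openConn o (x k))ᶜ ≤ s := fun k => hrel o ho (x k) (hxA k)
  have hss : ∀ k k', μ.real (openConn (x k) (x k'))ᶜ ≤ s := fun k k' => hrel (x k) (hxA k) (x k') (hxA k')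
  refine le_trans (measureReal_mono ?_) (real_two_le_lost_le_three_halves n w o x hxo hso hss)
  intro ω hω
  simp only [mem_setOf_eq] at hω ⊢
  obtain ⟨_, hlt⟩ := hω
  -- `EN ≤ 6`, so `N ≤ 3`
  have hEN : (∑ a ∈ A, μ.real (openConn o a)) ≤ 6 := by
    calc (∑ a ∈ A, μ.real (openConn o a)) ≤ ∑ a ∈ A, (1 : ℝ) :=
          Finset.sum_le_sum fun a _ => measureReal_le_one
      _ = 6 := by simp [h6]
  have hEN0 : (0 : ℝ) ≤ ∑ a ∈ A, μ.real (openConn o a) := Finset.sum_nonneg fun a _ => measureReal_nonneg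
  have hN3' : (A.filter fun a => ω ∈ openConn o a).card ≤ 3 := by
    have : ((A.filter fun a => ω ∈ openConn o a).card : ℝ) < 4 := by
      have : κ * (∑ a ∈ A, μ.real (openConn o a)) ≤ 2 / 3 * 6 := by nlinarith
      linarith
    exact_mod_cast Nat.lt_succ_iff.1 (by exact_mod_cast this)
  -- `o` and the kept points among `x 0, …, x 3` are all joined to `o`
  have hsub : insert o (B.filter fun a => ω ∈ openConn o a) ⊆ A.filter fun a => ω ∈ openConn o a := by
    intro b hb
    rcases Finset.mem_insert.1 hb with rfl | hb
    · exact Finset.mem_filter.2 ⟨ho, SimpleGraph.Reachable.refl _⟩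
    · exact Finset.mem_filter.2 ⟨(Finset.mem_erase.1 (Finset.mem_erase.1 (Finset.mem_filter.1 hb).1).2).2,
        (Finset.mem_filter.1 hb).2⟩
  have hoB : o ∉ B.filter fun a => ω ∈ openConn o a := fun h =>
    (Finset.mem_erase.1 (Finset.mem_erase.1 (Finset.mem_filter.1 h).1).2).1 rfl
  have hcard := Finset.card_le_card hsub
  rw [Finset.card_insert_of_notMem hoB] at hcard
  have hkept : (B.filter fun a => ω ∈ openConn o a).card =
      (Finset.univ.filter fun k : Fin 4 => ω ∈ openConn o (x k)).card := by
    rw [hBmap, Finset.filter_map, Finset.card_map]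
    rfl
  have hsplit := Finset.card_filter_add_card_filter_not (s := (Finset.univ : Finset (Fin 4)))
    (fun k : Fin 4 => ω ∈ openConn o (x k))
  rw [Finset.card_univ, Fintype.card_fin] at hsplit
  omega

/-- **(LT³⁄₂) for `|A| ≤ 6` with `o ∈ A`, in the conjecture's quantifier shape** (`Consts.LinearLowerTailThreeHalves` restricted
to `o ∈ A ∧ |A| ≤ 6`). [cite: KozmaNitzan2024, Conj. 1 (p. 3)] -/
theorem linearLowerTailThreeHalves_of_card_le_six :
    ∀ κ : ℝ, 0 < κ → κ ≤ 2 / 3 →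
      ∀ (n : ℕ) (w : Sym2 (Fin n) → unitInterval) (A : Finset (Fin n)) (o : Fin n) (s : ℝ), 0 ≤ s →
        o ∈ A → A.card ≤ 6 →
        (∀ a ∈ A, ∀ a' ∈ A, (prodBernoulli w).real (openConn a a')ᶜ ≤ s) →
        (prodBernoulli w).real {ω : BondConfig (Fin n) | 1 ≤ (A.filter fun a => ω ∈ openConn o a).card ∧
            ((A.filter fun a => ω ∈ openConn o a).card : ℝ) < κ * (∑ a ∈ A, (prodBernoulli w).real (openConn o a))} ≤
          3 / 2 * s := by
  intro κ _ hκ n w A o s _ ho hA hrel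
  exact real_lowerTail_le_three_halves_of_card_le_six n w A o ho hA hκ hrel


/-- **(LT³⁄₂) whenever `o ∈ A` and `κ·|A| ≤ 4`** (`κ ≤ 2/3`; all finite weighted graphs, all `s`): `P(1 ≤ N < κ·EN) ≤ (3/2)·s`.
This extends `Consts.real_lowerTail_le_three_halves_of_card_le` (`κ|A| ≤ 3`, pointwise) by one unit of `κ|A|` using the
five-point anti-halving lemma: if `|A| ≥ 5`, the bad event gives `N < κ·EN ≤ κ|A| ≤ 4`, so `o` keeps at most two of the other
relay points and loses at least two of any four fixed ones.  At `κ = 2/3` this is `|A| ≤ 6` again; at `κ ≤ 1/2` it covers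
`|A| ≤ 8`, at `κ ≤ 2/5` it covers `|A| ≤ 10`. [cite: KozmaNitzan2024, Conj. 1 (p. 3)] -/
theorem real_lowerTail_le_three_halves_of_mul_card_le_four (n : ℕ) (w : Sym2 (Fin n) → unitInterval) (A : Finset (Fin n))
    (o : Fin n) (ho : o ∈ A) {κ s : ℝ} (hκ : κ ≤ 2 / 3) (hκA : κ * A.card ≤ 4)
    (hrel : ∀ a ∈ A, ∀ a' ∈ A, (prodBernoulli w).real (openConn a a')ᶜ ≤ s) :
    (prodBernoulli w).real {ω : BondConfig (Fin n) | 1 ≤ (A.filter fun a => ω ∈ openConn o a).card ∧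
        ((A.filter fun a => ω ∈ openConn o a).card : ℝ) < κ * (∑ a ∈ A, (prodBernoulli w).real (openConn o a))} ≤
      3 / 2 * s := by
  set μ := prodBernoulli w with hμ
  by_cases h4 : A.card ≤ 4
  · have hκA3 : κ * A.card ≤ 3 := by
      have : (A.card : ℝ) ≤ 4 := by exact_mod_cast h4
      have hM0 : (0 : ℝ) ≤ A.card := Nat.cast_nonneg _
      nlinarith
    exact real_lowerTail_le_three_halves_of_card_le n w A o ho (by linarith) hκA3 hrel
  have h5 : 5 ≤ A.card := by omega
  -- four relay points other than `o`
  have hB4 : 4 ≤ (A.erase o).card := by rw [Finset.card_erase_of_mem ho]; omega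
  obtain ⟨B, hBsub, hBcard⟩ := Finset.exists_subset_card_eq hB4
  set ε := B.equivFinOfCardEq hBcard with hε
  set x : Fin 4 → Fin n := fun k => ((ε.symm k : B) : Fin n) with hx
  have hxB : ∀ k, x k ∈ B := fun k => (ε.symm k).2
  have hxo : ∀ k, x k ≠ o := fun k => (Finset.mem_erase.1 (hBsub (hxB k))).1
  have hxA : ∀ k, x k ∈ A := fun k => (Finset.mem_erase.1 (hBsub (hxB k))).2
  have hxinj : Function.Injective x := by
    intro k k' hkk'
    have : ε.symm k = ε.symm k' := Subtype.ext hkk'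
    exact ε.symm.injective this
  have hBmap : B = Finset.univ.map ⟨x, hxinj⟩ := by
    ext b
    simp only [Finset.mem_map, Finset.mem_univ, Function.Embedding.coeFn_mk, true_and]
    constructor
    · intro hb
      exact ⟨ε ⟨b, hb⟩, by simp [hx]⟩
    · rintro ⟨k, rfl⟩
      exact hxB k
  have hso : ∀ k, μ.real (openConn o (x k))ᶜ ≤ s := fun k => hrel o ho (x k) (hxA k)
  have hss : ∀ k k', μ.real (openConn (x k) (x k'))ᶜ ≤ s := fun k k' => hrel (x k) (hxA k) (x k') (hxA k')
  refine le_trans (measureReal_mono ?_) (real_two_le_lost_le_three_halves n w o x hxo hso hss)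
  intro ω hω
  simp only [mem_setOf_eq] at hω ⊢
  obtain ⟨_, hlt⟩ := hω
  -- `κ·EN ≤ κ·|A| ≤ 4`, so `N ≤ 3`
  have hEN : (∑ a ∈ A, μ.real (openConn o a)) ≤ A.card := by
    calc (∑ a ∈ A, μ.real (openConn o a)) ≤ ∑ a ∈ A, (1 : ℝ) :=
          Finset.sum_le_sum fun a _ => measureReal_le_one
      _ = A.card := by simp
  have hEN0 : (0 : ℝ) ≤ ∑ a ∈ A, μ.real (openConn o a) := Finset.sum_nonneg fun a _ => measureReal_nonneg
  have hκ0' : 0 ≤ κ ∨ κ < 0 := le_or_gt 0 κ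
  have hN3' : (A.filter fun a => ω ∈ openConn o a).card ≤ 3 := by
    have hlt4 : ((A.filter fun a => ω ∈ openConn o a).card : ℝ) < 4 := by
      rcases hκ0' with hκ0 | hκ0
      · have : κ * (∑ a ∈ A, μ.real (openConn o a)) ≤ κ * A.card := mul_le_mul_of_nonneg_left hEN hκ0
        linarith
      · have : κ * (∑ a ∈ A, μ.real (openConn o a)) ≤ 0 := mul_nonpos_of_nonpos_of_nonneg hκ0.le hEN0
        linarith
    exact_mod_cast Nat.lt_succ_iff.1 (by exact_mod_cast hlt4)
  -- `o` and the kept points among `x 0, …, x 3` are all joined to `o`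
  have hsub : insert o (B.filter fun a => ω ∈ openConn o a) ⊆ A.filter fun a => ω ∈ openConn o a := by
    intro b hb
    rcases Finset.mem_insert.1 hb with rfl | hb
    · exact Finset.mem_filter.2 ⟨ho, SimpleGraph.Reachable.refl _⟩
    · exact Finset.mem_filter.2 ⟨(Finset.mem_erase.1 (hBsub (Finset.mem_filter.1 hb).1)).2, (Finset.mem_filter.1 hb).2⟩
  have hoB : o ∉ B.filter fun a => ω ∈ openConn o a := fun h =>
    (Finset.mem_erase.1 (hBsub (Finset.mem_filter.1 h).1)).1 rfl
  have hcard := Finset.card_le_card hsub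
  rw [Finset.card_insert_of_notMem hoB] at hcard
  have hkept : (B.filter fun a => ω ∈ openConn o a).card =
      (Finset.univ.filter fun k : Fin 4 => ω ∈ openConn o (x k)).card := by
    rw [hBmap, Finset.filter_map, Finset.card_map]
    rfl
  have hsplit := Finset.card_filter_add_card_filter_not (s := (Finset.univ : Finset (Fin 4)))
    (fun k : Fin 4 => ω ∈ openConn o (x k))
  rw [Finset.card_univ, Fintype.card_fin] at hsplit
  omega

/-- **(LT³⁄₂) for `o ∈ A` with `κ·|A| ≤ 4`, in the conjecture's quantifier shape** (`Consts.LinearLowerTailThreeHalves` restricted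
to `o ∈ A ∧ κ|A| ≤ 4`; e.g. all `|A| ≤ 8` when `κ ≤ 1/2`). [cite: KozmaNitzan2024, Conj. 1 (p. 3)] -/
theorem linearLowerTailThreeHalves_of_mul_card_le_four :
    ∀ κ : ℝ, 0 < κ → κ ≤ 2 / 3 →
      ∀ (n : ℕ) (w : Sym2 (Fin n) → unitInterval) (A : Finset (Fin n)) (o : Fin n) (s : ℝ), 0 ≤ s →
        o ∈ A → κ * A.card ≤ 4 →
        (∀ a ∈ A, ∀ a' ∈ A, (prodBernoulli w).real (openConn a a')ᶜ ≤ s) →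
        (prodBernoulli w).real {ω : BondConfig (Fin n) | 1 ≤ (A.filter fun a => ω ∈ openConn o a).card ∧
            ((A.filter fun a => ω ∈ openConn o a).card : ℝ) < κ * (∑ a ∈ A, (prodBernoulli w).real (openConn o a))} ≤
          3 / 2 * s := by
  intro κ _ hκ n w A o s _ ho hκA hrel
  exact real_lowerTail_le_three_halves_of_mul_card_le_four n w A o ho hκ hκA hrel


/-- **The pair-loss inequality** (any observer `o`, two vertices `x, y ≠ o`, any finite set `Z ∌ o` of further vertices; write
"kept" for "joined to `o`").  `μ(x, y lost; Z kept) · μ(x lost; y kept) ≤ μ(x lost; y, Z kept) · μ(x, y lost)`: losing EXACTLY the pair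
`{x, y}` (relative to `Z`) times losing `x` without `y` is at most losing exactly `x` times losing both.  This is van den
Berg–Häggström–Kahn Thm. 1.3 given `{o ↮ x}` for the increasing events "`y ∈ C(o)`" and "`Z ⊆ C(o)`", after cancelling the common
terms; summed with its mirror image it gives `μ(T = {x,y}) · μ(|T ∩ {x,y}| = 1) ≤ (μ(T = {x}) + μ(T = {y})) · μ(T ⊇ {x,y})` for the lost
set `T` among `{x, y} ∪ Z` — the inequality behind `Consts.Five.core` ("fixed-size lost sets are negatively associated, percolation
clusters positively"). [cite: VandenbergHaggstromKahn2005, Thm. 1.3 (p. 6)] -/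
theorem real_pairLoss_mul_le (n : ℕ) (w : Sym2 (Fin n) → unitInterval) (o x y : Fin n) (Z : Finset (Fin n)) (hx : x ≠ o)
    (hy : y ≠ o) (hZ : o ∉ Z) :
    (prodBernoulli w).real ((openConn o x)ᶜ ∩ (openConn o y)ᶜ ∩ {ω | ∀ z ∈ Z, ω ∈ openConn o z}) *
        (prodBernoulli w).real ((openConn o x)ᶜ ∩ openConn o y) ≤
      (prodBernoulli w).real ((openConn o x)ᶜ ∩ openConn o y ∩ {ω | ∀ z ∈ Z, ω ∈ openConn o z}) *
        (prodBernoulli w).real ((openConn o x)ᶜ ∩ (openConn o y)ᶜ) := by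
  set μ := prodBernoulli w with hμ
  set D : Set (BondConfig (Fin n)) := (openConn o x)ᶜ with hD
  set A : Set (BondConfig (Fin n)) := openConn o y with hA
  set B : Set (BondConfig (Fin n)) := {ω | ∀ z ∈ Z, ω ∈ openConn o z} with hB
  -- vdBHK 1.3 in event form for the upper families "`y` in the span" and "`Z` in the span" of `C(o)`, given `o ↮ x`
  set 𝒜 : Set (Set (Sym2 (Fin n))) := {C | ∃ e ∈ C, y ∈ e} with h𝒜
  set ℬ : Set (Set (Sym2 (Fin n))) := {C | ∀ z ∈ Z, ∃ e ∈ C, z ∈ e} with hℬ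
  have h𝒜up : IsUpperSet 𝒜 := fun C C' hCC' ⟨e, he, hye⟩ => ⟨e, hCC' he, hye⟩
  have hℬup : IsUpperSet ℬ := fun C C' hCC' h z hz => by
    obtain ⟨e, he, hze⟩ := h z hz
    exact ⟨e, hCC' he, hze⟩
  have hoX : o ∉ ({x} : Set (Fin n)) := by simpa using hx.symm
  have hbhk := KNPreFKG.bhk_one_upper_upper w o ({x} : Set (Fin n)) hoX h𝒜up hℬup
  have hreach : ∀ (v : Fin n), v ≠ o → ∀ ω : BondConfig (Fin n),
      (∃ e ∈ openEdgeCluster ω o, v ∈ e) ↔ ω ∈ openConn o v := by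
    intro v hv ω
    rw [show (ω ∈ openConn o v) = (openGraph ω).Reachable o v from rfl, reachable_iff_exists_mem_openEdgeCluster]
    constructor
    · exact fun h => Or.inr h
    · rintro (h | h)
      · exact absurd h hv
      · exact h
  have hDset : {ω : BondConfig (Fin n) | ∀ v ∈ ({x} : Set (Fin n)), ¬ (openGraph ω).Reachable o v} = D := by
    ext ω; simp [hD, openConn]
  have hAset : {ω : BondConfig (Fin n) | openEdgeCluster ω o ∈ 𝒜} = A := by
    ext ω; simp only [h𝒜, hA, mem_setOf_eq]; exact hreach y hy ω
  have hBset : {ω : BondConfig (Fin n) | openEdgeCluster ω o ∈ ℬ} = B := by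
    ext ω
    simp only [hℬ, hB, mem_setOf_eq]
    refine forall₂_congr fun z hz => hreach z ?_ ω
    rintro rfl; exact hZ hz
  rw [hDset, hAset, hBset] at hbhk
  -- hbhk : μ(D ∩ A) * μ(D ∩ B) ≤ μ D * μ(D ∩ (A ∩ B)); split `D ∩ B` and `D` along `A`
  have hmA : MeasurableSet A := MeasurableSet.of_discrete
  have h1 : μ.real (D ∩ B) = μ.real ((D ∩ B) ∩ A) + μ.real ((D ∩ B) \ A) := (measureReal_inter_add_sdiff (s := D ∩ B) hmA).symm
  have h2 : μ.real D = μ.real (D ∩ A) + μ.real (D \ A) := (measureReal_inter_add_sdiff (s := D) hmA).symm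
  have e1 : (D ∩ B) ∩ A = D ∩ A ∩ B := by ext ω; simp only [mem_inter_iff]; tauto
  have e2 : (D ∩ B) \ A = D ∩ Aᶜ ∩ B := by ext ω; simp only [mem_inter_iff, mem_sdiff, mem_compl_iff]; tauto
  have e3 : D \ A = D ∩ Aᶜ := Set.sdiff_eq D A
  have e4 : D ∩ (A ∩ B) = D ∩ A ∩ B := (inter_assoc D A B).symm
  rw [e1, e2] at h1
  rw [e3] at h2
  rw [e4, h1, h2] at hbhk
  have hn1 : 0 ≤ μ.real (D ∩ A) := measureReal_nonneg
  have hn2 : 0 ≤ μ.real (D ∩ A ∩ B) := measureReal_nonneg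
  nlinarith [hbhk, hn1, hn2]

/-- **Pair-loss inequality, symmetric form**: with `T` the set of points of `{x, y} ∪ Z` cut from `o`,
`μ(T = {x,y}) · (μ(x lost, y kept) + μ(y lost, x kept)) ≤ (μ(T = {x}) + μ(T = {y})) · μ(x, y both lost)`.  A pair that is often
separated can be lost AS A PAIR only about as often as its two points are lost singly; a glued pair is unconstrained (the
hub-leaf gadget). [cite: VandenbergHaggstromKahn2005, Thm. 1.3 (p. 6)] -/
theorem real_pairLoss_sep_le (n : ℕ) (w : Sym2 (Fin n) → unitInterval) (o x y : Fin n) (Z : Finset (Fin n)) (hx : x ≠ o)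
    (hy : y ≠ o) (hZ : o ∉ Z) :
    (prodBernoulli w).real ((openConn o x)ᶜ ∩ (openConn o y)ᶜ ∩ {ω | ∀ z ∈ Z, ω ∈ openConn o z}) *
        ((prodBernoulli w).real ((openConn o x)ᶜ ∩ openConn o y) + (prodBernoulli w).real ((openConn o y)ᶜ ∩ openConn o x)) ≤
      ((prodBernoulli w).real ((openConn o x)ᶜ ∩ openConn o y ∩ {ω | ∀ z ∈ Z, ω ∈ openConn o z}) +
          (prodBernoulli w).real ((openConn o y)ᶜ ∩ openConn o x ∩ {ω | ∀ z ∈ Z, ω ∈ openConn o z})) *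
        (prodBernoulli w).real ((openConn o x)ᶜ ∩ (openConn o y)ᶜ) := by
  have h1 := real_pairLoss_mul_le n w o x y Z hx hy hZ
  have h2 := real_pairLoss_mul_le n w o y x Z hy hx hZ
  have e : (openConn o y)ᶜ ∩ (openConn o x)ᶜ = (openConn o x)ᶜ ∩ (openConn o y)ᶜ := inter_comm _ _
  rw [e] at h2
  nlinarith [h1, h2]

end Consts

end Summit.CriticalPhenomena.PercolationContinuityZ3.Theorems
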